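import Mathlib
import HarnessLib
import Summits.HubbardSuperconductivity.HubbardSuperconductivity.Theorems.KLProgrammeKLRegimeEngineFrameShiftDressingFactorTables
import Summits.HubbardSuperconductivity.HubbardSuperconductivity.Theorems.KLProgrammeKLRegimeEngineFrameLevelCount
import Summits.HubbardSuperconductivity.HubbardSuperconductivity.Theorems.KLProgrammeC4aLatticeTubeSum
import Summits.HubbardSuperconductivity.HubbardSuperconductivity.Theorems.KLProgrammeKLRegimeEngineFrameShiftSymbolMomentsFrames
import Literature.MathematicalPhysics.QuantumLattice.HubbardUVSymbolCTDifferences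

/-!
# K3 gen-8-FLOW (stmt 20437, stub (C), «(C)-B-REP» sup route S-d): the three continuum DRESSING SYMBOLS of the corrected (B) door along a pair of frames
# — identification with the lattice data, `2π`-periodicity, `D₄`-symmetry, smoothness, and VANISHING below the shell

Cell gate-hubbard-kl, seat p2 g14.  The model layer `…EngineFrameShiftDressingSup` (p2 g14) takes ABSTRACT symbols `s₀, s₁` and continuum factors `g, a, b` with
identification hypotheses.  For the door's pair of frames `K₁, K₂` at scale `Λ` (`s₀ = Ψ_{K₁} = uvSymbolCT … K₁ Λ`, `s₁ = Ψ̃` the mismatch-resummed symbol of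
`K₂` with mismatch `D = K₂ ⊖ K₁`) the factors are, with `u = e_{K₂} = frameLevel μ K₂`, `v = evalM (K₂ ⊖ K₁)`, `c = βL²`, `ω = ω_i`:
`Ψ̃(q) = w(ω,u)·resolventFnXi c 0 ω (u + w(ω,u)v)`, `d = Ψ̃ − Ψ(ω, u+v)` (tree factor `g`), `a = −(v²/c)·Ψ̃` (`J₂`), `b = (κΨ̃)² − 2κΨ̃`, `κΨ̃ = (v/c)Ψ̃` (`J₁`):

* §1 the band pair: `frameLevel`/`evalM` are reflection- and swap-symmetric at `toLp` points and `2π`-periodic (`frameLevel_toLp_reflect/_swap`,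
  `evalM_toLp_reflect/_swap`, `evalM_periodic_single`); `u + v = e_{K₁}` (`frameLevel_add_evalM_fsub`);
* §2 IDENTIFICATION at the lattice momenta (`0 < β`): `uvSymbolCT_resummed_eq` (`s₁ = Ψ̃∘p`), `uvSymbolCT_eq_symbolOld` (`s₀ = Ψ(ω,u+v)∘p`), hence
  **`mismatchDefect_eq_sample`** (`s₁ − s₀ = d∘p`), **`dressingJ₂_eq_sample`**, **`dressingJ₁_eq_sample`** (the `hs`, `hA`, `hB` of the model layer);
* §3 smoothness, periodicity and `D₄`-symmetry of `Ψ̃, d, a, b` (`contDiff_…`, `…_periodic`, `…_reflect`, `…_swap`);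
* §4 VANISHING below the shell: at `q` with `ω² + e_{K₂}(q)² < Λ²/4` (and `ω² + e_{K₁}(q)² < Λ²/4` for `d`) the factors vanish on a neighbourhood of `q`
  (`resummed_eventually_zero`, `defect_eventually_zero`, `dressingJ₂_eventually_zero`, `dressingJ₁_eventually_zero`).

Proofs only; no definitions; nothing about the model's sizes is asserted; nothing asserts superconductivity.
References: BGM 2006 §2.2 (2.23), (2.27)–(2.28) [cite: BenfattoGiulianiMastropietro2006]; FST 1996 §1 [cite: FeldmanSalmhoferTrubowitz1996].
-/

noncomputable section

namespace Summit.HubbardSuperconductivity.HubbardSuperconductivity.Theorems.EngineV8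

set_option linter.dupNamespace false -- summit = problem name (single-conjunct summit), D-0017

open Real Finset Filter Literature.MathematicalPhysics.QuantumLattice Literature.Probability.LatticeModels
open Summit.HubbardSuperconductivity.HubbardSuperconductivity.Theorems.KLRegimeSplit
open Summit.HubbardSuperconductivity.HubbardSuperconductivity.Theorems.DispersionFlow
open Summit.HubbardSuperconductivity.HubbardSuperconductivity.Theorems.C4a

variable {L M : ℕ} [NeZero L]

/-! ## §1 The band pair `u = e_{K₂}`, `v = evalM (K₂ ⊖ K₁)` -/

omit [NeZero L] in
/-- The frame band is reflection-symmetric. -/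
theorem frameLevel_toLp_reflect (μ : ℝ) (K : TrigPolyC4v) (p : Fin 2 → ℝ) :
    frameLevel μ K (WithLp.toLp 2 ![p 0, -p 1]) = frameLevel μ K (WithLp.toLp 2 p) := by
  simp only [frameLevel, squareDispersion, TrigPolyC4v.eval_reflect]
  simp [Real.cos_neg]

omit [NeZero L] in
/-- The frame band is swap-symmetric. -/
theorem frameLevel_toLp_swap (μ : ℝ) (K : TrigPolyC4v) (p : Fin 2 → ℝ) :
    frameLevel μ K (WithLp.toLp 2 ![p 1, p 0]) = frameLevel μ K (WithLp.toLp 2 p) := by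
  simp only [frameLevel, squareDispersion, TrigPolyC4v.eval_swap]
  simp [add_comm]

omit [NeZero L] in
/-- `evalM` of a frame is reflection-symmetric. -/
theorem evalM_toLp_reflect (A : TrigPolyC4v) (p : Fin 2 → ℝ) : evalM A (WithLp.toLp 2 ![p 0, -p 1]) = evalM A (WithLp.toLp 2 p) := by
  simp only [evalM_apply]
  exact TrigPolyC4v.eval_reflect A p

omit [NeZero L] in
/-- `evalM` of a frame is swap-symmetric. -/
theorem evalM_toLp_swap (A : TrigPolyC4v) (p : Fin 2 → ℝ) : evalM A (WithLp.toLp 2 ![p 1, p 0]) = evalM A (WithLp.toLp 2 p) := by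
  simp only [evalM_apply]
  exact TrigPolyC4v.eval_swap A p

omit [NeZero L] in
/-- `evalM` of a frame is `2π`-periodic in each coordinate. -/
theorem evalM_periodic_single (A : TrigPolyC4v) (c : Fin 2) (q : Momentum) : evalM A (q + EuclideanSpace.single c (2 * π)) = evalM A q := by
  have h1 := frameLevel_periodic_single 0 A c q
  have h0 := frameLevel_periodic_single 0 0 c q
  rw [frameLevel_eq_zero_sub_evalM 0 A, frameLevel_eq_zero_sub_evalM 0 A q] at h1
  linarith

omit [NeZero L] in
/-- `e_{K₂} + evalM (K₂ ⊖ K₁) = e_{K₁}` pointwise. -/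
theorem frameLevel_add_evalM_fsub (μ : ℝ) (K₁ K₂ : TrigPolyC4v) (q : Momentum) :
    frameLevel μ K₂ q + evalM (fsub K₂ K₁) q = frameLevel μ K₁ q := by
  rw [frameLevel_eq_zero_sub_evalM μ K₂, frameLevel_eq_zero_sub_evalM μ K₁, evalM_fsub]
  ring

/-! ## §2 Identification with the lattice data -/

section Ident

variable {β : ℝ} (hβ : 0 < β) (μ : ℝ) (K₁ K₂ : TrigPolyC4v) (Λ : ℝ)
include hβ

/-- **The mismatch-resummed lattice symbol is the sampled `Ψ̃`**: with `u = e_{K₂}`, `v = evalM (K₂ ⊖ K₁)`, `c = βL²`, `ω = ω_i`,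
`Ψ_{K₂}/(1 + Ψ_{K₂}·D(p_k)/c) = w(ω,u(p_k))·resolventFnXi c 0 ω (u(p_k) + w(ω,u(p_k))·v(p_k))`. [cite: BenfattoGiulianiMastropietro2006, §2.2 (2.23)] -/
theorem uvSymbolCT_resummed_eq (i : MatsubaraIdx M) (kv : TorusSite 2 L) (σ : Fin 2) :
    uvSymbolCT L M β μ K₂ Λ ((i, kv), σ) /
        (1 + uvSymbolCT L M β μ K₂ Λ ((i, kv), σ) * (((fsub K₂ K₁).eval (latticeMomentum L kv) / (β * (L : ℝ) ^ 2) : ℝ) : ℂ)) =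
      ((uvWeightFn Λ (matsubaraFreq β M i) (frameLevel μ K₂ (WithLp.toLp 2 (latticeMomentum L kv))) : ℝ) : ℂ) *
        resolventFnXi (β * (L : ℝ) ^ 2) 0 (matsubaraFreq β M i)
          (frameLevel μ K₂ (WithLp.toLp 2 (latticeMomentum L kv)) +
            uvWeightFn Λ (matsubaraFreq β M i) (frameLevel μ K₂ (WithLp.toLp 2 (latticeMomentum L kv))) *
              evalM (fsub K₂ K₁) (WithLp.toLp 2 (latticeMomentum L kv))) := by
  have hω : matsubaraFreq β M i ≠ 0 := matsubaraFreq_ne_zero hβ.ne' i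
  set e := frameLevel μ K₂ (WithLp.toLp 2 (latticeMomentum L kv)) with he
  set x := (fsub K₂ K₁).eval (latticeMomentum L kv) with hx
  have hxe : evalM (fsub K₂ K₁) (WithLp.toLp 2 (latticeMomentum L kv)) = x := rfl
  have h := uvResummedFn_eq_weight_mul_resolvent hω (β * (L : ℝ) ^ 2) Λ (e + x) x
  rw [add_sub_cancel_right] at h
  rw [uvSymbolCT_eq_uvSymbolFn hβ, EngineV8.nambuXiCT_eq_frameLevel, hxe, ← he, ← h, uvResummedFn, add_sub_cancel_right]

/-- **The old frame's lattice symbol is the plain symbol along `u + v`**: `Ψ_{K₁}((i,k),σ) = uvSymbolFnXi c Λ ω (u(p_k) + v(p_k))`.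
[cite: BenfattoGiulianiMastropietro2006, §2.2 (2.23)] -/
theorem uvSymbolCT_eq_symbolOld (i : MatsubaraIdx M) (kv : TorusSite 2 L) (σ : Fin 2) :
    uvSymbolCT L M β μ K₁ Λ ((i, kv), σ) =
      uvSymbolFnXi (β * (L : ℝ) ^ 2) Λ (matsubaraFreq β M i)
        (frameLevel μ K₂ (WithLp.toLp 2 (latticeMomentum L kv)) + evalM (fsub K₂ K₁) (WithLp.toLp 2 (latticeMomentum L kv))) := by
  rw [uvSymbolCT_eq_uvSymbolFn hβ, EngineV8.nambuXiCT_eq_frameLevel, frameLevel_add_evalM_fsub, uvSymbolFn_eq_uvSymbolFnXi]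

/-- **`s₁ − s₀ = d∘p`**: the single-scale defect of the mismatch-resummed representation at the lattice momenta is the sampled continuum defect `d`
(the `hs` of `norm_iteratedFDeriv_symInterp_treeData_le`). [cite: BenfattoGiulianiMastropietro2006, §2.2 (2.27)–(2.28)] -/
theorem mismatchDefect_eq_sample (i : MatsubaraIdx M) (kv : TorusSite 2 L) (σ : Fin 2) :
    uvSymbolCT L M β μ K₂ Λ ((i, kv), σ) /
        (1 + uvSymbolCT L M β μ K₂ Λ ((i, kv), σ) * (((fsub K₂ K₁).eval (latticeMomentum L kv) / (β * (L : ℝ) ^ 2) : ℝ) : ℂ)) -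
        uvSymbolCT L M β μ K₁ Λ ((i, kv), σ) =
      (fun q : Momentum => ((uvWeightFn Λ (matsubaraFreq β M i) (frameLevel μ K₂ q) : ℝ) : ℂ) *
          resolventFnXi (β * (L : ℝ) ^ 2) 0 (matsubaraFreq β M i) (frameLevel μ K₂ q + uvWeightFn Λ (matsubaraFreq β M i) (frameLevel μ K₂ q) *
            evalM (fsub K₂ K₁) q) -
        uvSymbolFnXi (β * (L : ℝ) ^ 2) Λ (matsubaraFreq β M i) (frameLevel μ K₂ q + evalM (fsub K₂ K₁) q)) (WithLp.toLp 2 (latticeMomentum L kv)) := by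
  rw [uvSymbolCT_resummed_eq hβ, uvSymbolCT_eq_symbolOld hβ μ K₁ K₂]

/-- **`A = a∘p`** for the `J₂` datum `−c·κ²·Ψ̃`, `κ = D(p_k)/c`: the sampled `a = −(v²/c)·Ψ̃`. [cite: BenfattoGiulianiMastropietro2006, §2.2 (2.23)] -/
theorem dressingJ₂_eq_sample (i : MatsubaraIdx M) (kv : TorusSite 2 L) (σ : Fin 2) :
    -(((β * (L : ℝ) ^ 2 : ℝ) : ℂ) * (((fsub K₂ K₁).eval (latticeMomentum L kv) / (β * (L : ℝ) ^ 2) : ℝ) : ℂ) ^ 2 *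
        (uvSymbolCT L M β μ K₂ Λ ((i, kv), σ) /
          (1 + uvSymbolCT L M β μ K₂ Λ ((i, kv), σ) * (((fsub K₂ K₁).eval (latticeMomentum L kv) / (β * (L : ℝ) ^ 2) : ℝ) : ℂ)))) =
      (fun q : Momentum => -((((evalM (fsub K₂ K₁) q * evalM (fsub K₂ K₁) q) / (β * (L : ℝ) ^ 2) : ℝ)) : ℂ) *
        (((uvWeightFn Λ (matsubaraFreq β M i) (frameLevel μ K₂ q) : ℝ) : ℂ) *
          resolventFnXi (β * (L : ℝ) ^ 2) 0 (matsubaraFreq β M i) (frameLevel μ K₂ q + uvWeightFn Λ (matsubaraFreq β M i) (frameLevel μ K₂ q) *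
            evalM (fsub K₂ K₁) q))) (WithLp.toLp 2 (latticeMomentum L kv)) := by
  have hL : (0 : ℝ) < L := by exact_mod_cast NeZero.pos L
  have hc : (β * (L : ℝ) ^ 2) ≠ 0 := by positivity
  rw [uvSymbolCT_resummed_eq hβ]
  have hxe : evalM (fsub K₂ K₁) (WithLp.toLp 2 (latticeMomentum L kv)) = (fsub K₂ K₁).eval (latticeMomentum L kv) := rfl
  simp only [hxe]
  have key : -(((β * (L : ℝ) ^ 2 : ℝ) : ℂ) * ((((fsub K₂ K₁).eval (latticeMomentum L kv) / (β * (L : ℝ) ^ 2) : ℝ) : ℂ) ^ 2)) =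
      -(((((fsub K₂ K₁).eval (latticeMomentum L kv) * (fsub K₂ K₁).eval (latticeMomentum L kv)) / (β * (L : ℝ) ^ 2) : ℝ)) : ℂ) := by
    push_cast
    field_simp
  rw [← key]
  ring

/-- **`B = b∘p`** for the `J₁` datum `(1 − κΨ̃)² − 1`: the sampled `b = (κΨ̃)·(κΨ̃) − 2·κΨ̃`, `κΨ̃ = (v/c)Ψ̃`. [cite: BenfattoGiulianiMastropietro2006, §2.2 (2.23)] -/
theorem dressingJ₁_eq_sample (i : MatsubaraIdx M) (kv : TorusSite 2 L) (σ : Fin 2) :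
    (1 - (((fsub K₂ K₁).eval (latticeMomentum L kv) / (β * (L : ℝ) ^ 2) : ℝ) : ℂ) *
        (uvSymbolCT L M β μ K₂ Λ ((i, kv), σ) /
          (1 + uvSymbolCT L M β μ K₂ Λ ((i, kv), σ) * (((fsub K₂ K₁).eval (latticeMomentum L kv) / (β * (L : ℝ) ^ 2) : ℝ) : ℂ)))) ^ 2 - 1 =
      (fun q : Momentum =>
        ((((evalM (fsub K₂ K₁) q / (β * (L : ℝ) ^ 2) : ℝ)) : ℂ) *
            (((uvWeightFn Λ (matsubaraFreq β M i) (frameLevel μ K₂ q) : ℝ) : ℂ) *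
              resolventFnXi (β * (L : ℝ) ^ 2) 0 (matsubaraFreq β M i) (frameLevel μ K₂ q +
                uvWeightFn Λ (matsubaraFreq β M i) (frameLevel μ K₂ q) * evalM (fsub K₂ K₁) q))) *
          ((((evalM (fsub K₂ K₁) q / (β * (L : ℝ) ^ 2) : ℝ)) : ℂ) *
            (((uvWeightFn Λ (matsubaraFreq β M i) (frameLevel μ K₂ q) : ℝ) : ℂ) *
              resolventFnXi (β * (L : ℝ) ^ 2) 0 (matsubaraFreq β M i) (frameLevel μ K₂ q +
                uvWeightFn Λ (matsubaraFreq β M i) (frameLevel μ K₂ q) * evalM (fsub K₂ K₁) q))) -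
        (2 : ℂ) * ((((evalM (fsub K₂ K₁) q / (β * (L : ℝ) ^ 2) : ℝ)) : ℂ) *
            (((uvWeightFn Λ (matsubaraFreq β M i) (frameLevel μ K₂ q) : ℝ) : ℂ) *
              resolventFnXi (β * (L : ℝ) ^ 2) 0 (matsubaraFreq β M i) (frameLevel μ K₂ q +
                uvWeightFn Λ (matsubaraFreq β M i) (frameLevel μ K₂ q) * evalM (fsub K₂ K₁) q)))) (WithLp.toLp 2 (latticeMomentum L kv)) := by
  rw [uvSymbolCT_resummed_eq hβ]
  have hxe : evalM (fsub K₂ K₁) (WithLp.toLp 2 (latticeMomentum L kv)) = (fsub K₂ K₁).eval (latticeMomentum L kv) := rfl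
  simp only [hxe]
  ring

end Ident

/-! ## §3 Smoothness, periodicity and `D₄`-symmetry of the dressing symbols -/

section Symmetry

variable (μ : ℝ) (K₁ K₂ : TrigPolyC4v) (c Λ ω : ℝ)

omit [NeZero L] in
/-- A symbol built from the band pair `(u, v) = (e_{K₂}, evalM (K₂ ⊖ K₁))` inherits periodicity and `D₄`-symmetry. -/
theorem bandPair_comp_invariant {E : Type*} (Φ : ℝ → ℝ → E) :
    (∀ (i : Fin 2) (q : Momentum), (fun q => Φ (frameLevel μ K₂ q) (evalM (fsub K₂ K₁) q)) (q + EuclideanSpace.single i (2 * π)) =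
      (fun q => Φ (frameLevel μ K₂ q) (evalM (fsub K₂ K₁) q)) q) ∧
    (∀ p : Fin 2 → ℝ, (fun q => Φ (frameLevel μ K₂ q) (evalM (fsub K₂ K₁) q)) (WithLp.toLp 2 ![p 0, -p 1]) =
      (fun q => Φ (frameLevel μ K₂ q) (evalM (fsub K₂ K₁) q)) (WithLp.toLp 2 p)) ∧
    (∀ p : Fin 2 → ℝ, (fun q => Φ (frameLevel μ K₂ q) (evalM (fsub K₂ K₁) q)) (WithLp.toLp 2 ![p 1, p 0]) =
      (fun q => Φ (frameLevel μ K₂ q) (evalM (fsub K₂ K₁) q)) (WithLp.toLp 2 p)) := by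
  refine ⟨fun i q => ?_, fun p => ?_, fun p => ?_⟩
  · simp only [frameLevel_periodic_single, evalM_periodic_single]
  · simp only [frameLevel_toLp_reflect, evalM_toLp_reflect]
  · simp only [frameLevel_toLp_swap, evalM_toLp_swap]

omit [NeZero L] in
/-- `Ψ̃` along the frames is smooth (`ω ≠ 0`). -/
theorem contDiff_resummedSymbol (hω : ω ≠ 0) :
    ContDiff ℝ (⊤ : ℕ∞) (fun q : Momentum => ((uvWeightFn Λ ω (frameLevel μ K₂ q) : ℝ) : ℂ) *
      resolventFnXi c 0 ω (frameLevel μ K₂ q + uvWeightFn Λ ω (frameLevel μ K₂ q) * evalM (fsub K₂ K₁) q)) := by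
  have hω0 : ω + 0 ≠ 0 := by rwa [add_zero]
  have hu : ContDiff ℝ (⊤ : ℕ∞) (frameLevel μ K₂) := EngineV8.contDiff_frameLevel μ K₂
  have hv : ContDiff ℝ (⊤ : ℕ∞) (evalM (fsub K₂ K₁)) := contDiff_evalM _
  exact (Complex.ofRealCLM.contDiff.comp ((contDiff_uvWeightFn_band Λ ω).comp hu)).mul
    ((contDiff_resolventFnXi (c := c) hω0).comp (hu.add (((contDiff_uvWeightFn_band Λ ω).comp hu).mul hv)))

omit [NeZero L] in
/-- The defect `d = Ψ̃ − Ψ(ω, u+v)` is smooth (`ω ≠ 0`). -/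
theorem contDiff_defectSymbol (hω : ω ≠ 0) :
    ContDiff ℝ (⊤ : ℕ∞) (fun q : Momentum => ((uvWeightFn Λ ω (frameLevel μ K₂ q) : ℝ) : ℂ) *
        resolventFnXi c 0 ω (frameLevel μ K₂ q + uvWeightFn Λ ω (frameLevel μ K₂ q) * evalM (fsub K₂ K₁) q) -
      uvSymbolFnXi c Λ ω (frameLevel μ K₂ q + evalM (fsub K₂ K₁) q)) :=
  (contDiff_resummedSymbol μ K₁ K₂ c Λ ω hω).sub
    ((contDiff_uvSymbolFnXi (c := c) (Λ := Λ) hω).comp ((EngineV8.contDiff_frameLevel μ K₂).add (contDiff_evalM _)))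

omit [NeZero L] in
/-- `κΨ̃ = (v/c)·Ψ̃` is smooth. -/
theorem contDiff_kappaPsiSymbol (hω : ω ≠ 0) :
    ContDiff ℝ (⊤ : ℕ∞) (fun q : Momentum => (((evalM (fsub K₂ K₁) q / c : ℝ)) : ℂ) *
      (((uvWeightFn Λ ω (frameLevel μ K₂ q) : ℝ) : ℂ) *
        resolventFnXi c 0 ω (frameLevel μ K₂ q + uvWeightFn Λ ω (frameLevel μ K₂ q) * evalM (fsub K₂ K₁) q))) :=
  (Complex.ofRealCLM.contDiff.comp ((contDiff_evalM _).div_const c)).mul (contDiff_resummedSymbol μ K₁ K₂ c Λ ω hω)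

omit [NeZero L] in
/-- The `J₂` factor `a = −(v²/c)·Ψ̃` is smooth. -/
theorem contDiff_dressingJ₂Symbol (hω : ω ≠ 0) :
    ContDiff ℝ (⊤ : ℕ∞) (fun q : Momentum => -((((evalM (fsub K₂ K₁) q * evalM (fsub K₂ K₁) q) / c : ℝ)) : ℂ) *
      (((uvWeightFn Λ ω (frameLevel μ K₂ q) : ℝ) : ℂ) *
        resolventFnXi c 0 ω (frameLevel μ K₂ q + uvWeightFn Λ ω (frameLevel μ K₂ q) * evalM (fsub K₂ K₁) q))) :=
  (Complex.ofRealCLM.contDiff.comp (((contDiff_evalM _).mul (contDiff_evalM _)).div_const c)).neg.mul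
    (contDiff_resummedSymbol μ K₁ K₂ c Λ ω hω)

omit [NeZero L] in
/-- The `J₁` factor `b = (κΨ̃)·(κΨ̃) − 2·κΨ̃` is smooth. -/
theorem contDiff_dressingJ₁Symbol (hω : ω ≠ 0) :
    ContDiff ℝ (⊤ : ℕ∞) (fun q : Momentum =>
      ((((evalM (fsub K₂ K₁) q / c : ℝ)) : ℂ) * (((uvWeightFn Λ ω (frameLevel μ K₂ q) : ℝ) : ℂ) *
          resolventFnXi c 0 ω (frameLevel μ K₂ q + uvWeightFn Λ ω (frameLevel μ K₂ q) * evalM (fsub K₂ K₁) q))) *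
        ((((evalM (fsub K₂ K₁) q / c : ℝ)) : ℂ) * (((uvWeightFn Λ ω (frameLevel μ K₂ q) : ℝ) : ℂ) *
          resolventFnXi c 0 ω (frameLevel μ K₂ q + uvWeightFn Λ ω (frameLevel μ K₂ q) * evalM (fsub K₂ K₁) q))) -
      (2 : ℂ) * ((((evalM (fsub K₂ K₁) q / c : ℝ)) : ℂ) * (((uvWeightFn Λ ω (frameLevel μ K₂ q) : ℝ) : ℂ) *
          resolventFnXi c 0 ω (frameLevel μ K₂ q + uvWeightFn Λ ω (frameLevel μ K₂ q) * evalM (fsub K₂ K₁) q)))) :=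
  ((contDiff_kappaPsiSymbol μ K₁ K₂ c Λ ω hω).mul (contDiff_kappaPsiSymbol μ K₁ K₂ c Λ ω hω)).sub
    (contDiff_const.mul (contDiff_kappaPsiSymbol μ K₁ K₂ c Λ ω hω))

end Symmetry

/-! ## §4 Vanishing below the shell -/

section Vanish

variable (μ : ℝ) (K₁ K₂ : TrigPolyC4v) (c : ℝ) {Λ : ℝ} (hΛ : 0 < Λ) (ω : ℝ)
include hΛ

omit [NeZero L] in
/-- **`Ψ̃` vanishes near every below-shell point**: `ω² + e_{K₂}(q)² < Λ²/4 ⟹ Ψ̃ = 0` on a neighbourhood of `q`.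
[cite: BenfattoGiulianiMastropietro2006, §2.2 (2.23)] -/
theorem resummed_eventually_zero {q : Momentum} (hq : ω ^ 2 + frameLevel μ K₂ q ^ 2 < Λ ^ 2 / 4) :
    ∀ᶠ q' in nhds q, ((uvWeightFn Λ ω (frameLevel μ K₂ q') : ℝ) : ℂ) *
      resolventFnXi c 0 ω (frameLevel μ K₂ q' + uvWeightFn Λ ω (frameLevel μ K₂ q') * evalM (fsub K₂ K₁) q') = 0 := by
  have hopen : ∀ᶠ q' in nhds q, ω ^ 2 + frameLevel μ K₂ q' ^ 2 < Λ ^ 2 / 4 :=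
    (continuous_const.add ((EngineV8.contDiff_frameLevel μ K₂ (n := 0)).continuous.pow 2)).continuousAt.eventually (gt_mem_nhds hq)
  filter_upwards [hopen] with q' hq'
  rw [(uvWeightFn_eq_zero_of_lt hΛ (e := ω) (ω := frameLevel μ K₂ q') (by linarith)).1, Complex.ofReal_zero, zero_mul]

omit [NeZero L] in
/-- **The defect `d` vanishes near every point below BOTH shells**. [cite: BenfattoGiulianiMastropietro2006, §2.2 (2.27)–(2.28)] -/
theorem defect_eventually_zero {q : Momentum} (hq₂ : ω ^ 2 + frameLevel μ K₂ q ^ 2 < Λ ^ 2 / 4) (hq₁ : ω ^ 2 + frameLevel μ K₁ q ^ 2 < Λ ^ 2 / 4) :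
    ∀ᶠ q' in nhds q, ((uvWeightFn Λ ω (frameLevel μ K₂ q') : ℝ) : ℂ) *
        resolventFnXi c 0 ω (frameLevel μ K₂ q' + uvWeightFn Λ ω (frameLevel μ K₂ q') * evalM (fsub K₂ K₁) q') -
      uvSymbolFnXi c Λ ω (frameLevel μ K₂ q' + evalM (fsub K₂ K₁) q') = 0 := by
  have hopen : ∀ᶠ q' in nhds q, ω ^ 2 + frameLevel μ K₁ q' ^ 2 < Λ ^ 2 / 4 :=
    (continuous_const.add ((EngineV8.contDiff_frameLevel μ K₁ (n := 0)).continuous.pow 2)).continuousAt.eventually (gt_mem_nhds hq₁)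
  filter_upwards [resummed_eventually_zero μ K₁ K₂ c hΛ ω hq₂, hopen] with q' h₂ h₁
  rw [h₂, zero_sub, neg_eq_zero, frameLevel_add_evalM_fsub, uvSymbolFnXi,
    (uvWeightFn_eq_zero_of_lt hΛ (e := ω) (ω := frameLevel μ K₁ q') (by linarith)).1, Complex.ofReal_zero, zero_mul]

omit [NeZero L] in
/-- The `J₂` factor vanishes near every below-shell point. [cite: BenfattoGiulianiMastropietro2006, §2.2 (2.23)] -/
theorem dressingJ₂_eventually_zero {q : Momentum} (hq : ω ^ 2 + frameLevel μ K₂ q ^ 2 < Λ ^ 2 / 4) :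
    ∀ᶠ q' in nhds q, -((((evalM (fsub K₂ K₁) q' * evalM (fsub K₂ K₁) q') / c : ℝ)) : ℂ) *
      (((uvWeightFn Λ ω (frameLevel μ K₂ q') : ℝ) : ℂ) *
        resolventFnXi c 0 ω (frameLevel μ K₂ q' + uvWeightFn Λ ω (frameLevel μ K₂ q') * evalM (fsub K₂ K₁) q')) = 0 := by
  filter_upwards [resummed_eventually_zero μ K₁ K₂ c hΛ ω hq] with q' h
  rw [h, mul_zero]

omit [NeZero L] in
/-- The `J₁` factor vanishes near every below-shell point. [cite: BenfattoGiulianiMastropietro2006, §2.2 (2.23)] -/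
theorem dressingJ₁_eventually_zero {q : Momentum} (hq : ω ^ 2 + frameLevel μ K₂ q ^ 2 < Λ ^ 2 / 4) :
    ∀ᶠ q' in nhds q,
      ((((evalM (fsub K₂ K₁) q' / c : ℝ)) : ℂ) * (((uvWeightFn Λ ω (frameLevel μ K₂ q') : ℝ) : ℂ) *
          resolventFnXi c 0 ω (frameLevel μ K₂ q' + uvWeightFn Λ ω (frameLevel μ K₂ q') * evalM (fsub K₂ K₁) q'))) *
        ((((evalM (fsub K₂ K₁) q' / c : ℝ)) : ℂ) * (((uvWeightFn Λ ω (frameLevel μ K₂ q') : ℝ) : ℂ) *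
          resolventFnXi c 0 ω (frameLevel μ K₂ q' + uvWeightFn Λ ω (frameLevel μ K₂ q') * evalM (fsub K₂ K₁) q'))) -
      (2 : ℂ) * ((((evalM (fsub K₂ K₁) q' / c : ℝ)) : ℂ) * (((uvWeightFn Λ ω (frameLevel μ K₂ q') : ℝ) : ℂ) *
          resolventFnXi c 0 ω (frameLevel μ K₂ q' + uvWeightFn Λ ω (frameLevel μ K₂ q') * evalM (fsub K₂ K₁) q'))) = 0 := by
  filter_upwards [resummed_eventually_zero μ K₁ K₂ c hΛ ω hq] with q' h
  rw [h, mul_zero, mul_zero, mul_zero, sub_zero]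

end Vanish

end Summit.HubbardSuperconductivity.HubbardSuperconductivity.Theorems.EngineV8

end
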